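import Mathlib
import HarnessLib
import Summits.NavierStokesRegularity.NavierStokesRegularity.Theorems.TypeILiouvilleSteadySieve
import Summits.NavierStokesRegularity.NavierStokesRegularity.Theorems.TypeILiouvilleShorelineContinuation

/-!
# TypeILiouvilleRecurrentEternalBridge — crux (L) stmt-NavierStokesRegularity-10661 `TypeIliouvilleL`:
# EVERY SLICE OF A UNIFORMLY RECURRENT BOUNDED ANCIENT FLOW IS A SLICE OF AN ETERNAL ONE —
# THE WHOLE RECURRENT STRATUM OF (L) IS CARRIED BY ETERNAL LIOUVILLE

Helper for stmt-NavierStokesRegularity-10661 (`--supports`); theorems only, no definitions, no named-fact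
hypotheses; closes no item; Navier–Stokes regularity is NOT proved here (leafhand seat of the EulerZoomLiouville
route).  Class P = print's class of bounded ancient mild solutions (`v : ℝ → ℝ³ → ℝ³` continuous and bounded on
`(−∞,0) × ℝ³`, weakly divergence free, `v(t) = e^{(t−s)Δ}v(s) − B¹_s(v,v)(t)` for `s < t < 0`).
UNIFORMLY RECURRENT PAST (the special stratum of the steady sieve `TypeILiouvilleSteadySieve`, typed verbatim as
there): `∀ t < 0, ∀ ε > 0, ∀ T < 0, ∃ s < T, ∀ x, ‖v s x − v t x‖ ≤ ε` — every slice recurs, uniformly in space,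
arbitrarily far in the past; ⊇ steady ∪ time-periodic ∪ almost-periodic bounded ancient flows.

The steady sieve proved that the fading doors L_Q / BCL / LSL and door stmt-4050 hold OUTRIGHT on this stratum and
that ETERNAL LIOUVILLE EL (stmt-18161) carries the bounded STEADY classical Liouville problem; the exact sieved cut
is `(L) ⟺ EL ∧ BCL|non-recurrent ∧ LSL|non-recurrent` (`liouvilleL_iff_sieved`).  Here the recurrent stratum is
put into the eternal door IN FULL, by compactness instead of an explicit extension:

* §1 `exists_eternal_through_slice_of_recurrent` — **for a uniformly recurrent class-P flow `v` and any `t₀ < 0`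
  there is an ETERNAL bounded Oseen-mild flow `W` on `ℝ × ℝ³` (continuous, weakly divergence free, same bound,
  Oseen identity between ALL pairs of times) with `W(0, ·) = v(t₀, ·)`.**  Proof: recurrence times `s_k < −(k+2)`
  with `sup_x ‖v(s_k) − v(t₀)‖ ≤ 1/(k+1)`; the time-translates `v(· + s_k)` live on the windows `(−∞, −s_k)`
  (`printClass_translate_window`); the tree's two-sided KNSS Lemma 6.1 engine `exists_oseenMild_eternal_limit`
  extracts an eternal limit `W` with `v(s_{k_j}, x) → W(0, x)`, while `v(s_k, x) → v(t₀, x)`.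
* §2 `exists_eternal_extension_of_recurrent` — moreover `W(t − t₀) = v(t)` for ALL `t₀ ≤ t < 0` (forward
  uniqueness in class P, `classP_eq_after_of_slice_eq`): every back-window `[t₀, 0)` of a uniformly recurrent
  bounded ancient flow EMBEDS INTO AN ETERNAL bounded mild flow.
* §4 (appended) `exists_eternal_through_slice_of_pointwiseRecurrent`, `alphaRecurrentLiouville_of_eternalLiouville` —
  POINTWISE α-recurrence of each slice along SOME `s_k → −∞` already suffices for §1 and §3.
* §3 `recurrentLiouville_of_eternalLiouville` — **EL ⟹ every uniformly recurrent class-P flow is ONE constant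
  vector** (EL by name on the eternal flow through each slice, `eternal_package`; KNSS Remark 6.1 glues the slice
  constants); `recurrentLiouville_of_liouvilleL`.  Supersedes the steady (`steadyLiouville_of_eternalLiouville`) and
  time-periodic (`TypeILiouvillePeriodicEternalBridge.periodicLiouville_of_eternalLiouville`, via the steady sieve's
  `recurrent_of_periodic`) bridges at the level of class P.

READING: with `liouvilleL_iff_sieved`, the part of (L) «open even in the steady-state case» (KNSS 2009 p. 3) — steady,
periodic, almost-periodic, any uniformly recurrent bounded ancient flow — is EXACTLY a question about ETERNAL flows;
the registered residual L_Q never sees it.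
[cite: KochNadirashviliSereginSverak2009, §1 p. 3, §4 (i), Lemma 6.1, Remark 6.1 (arXiv:0709.3599)]
-/

noncomputable section

open MeasureTheory Filter Set Function Metric
open scoped Topology
open Literature.Analysis Literature.Analysis.FluidPDE Literature.Analysis.UnboundedOperators
open Summit.NavierStokesRegularity.NavierStokesRegularity
open Summit.NavierStokesRegularity.NavierStokesRegularity.Theorems.TypeILiouvilleShoreline

set_option linter.dupNamespace false

namespace Summit.NavierStokesRegularity.NavierStokesRegularity.Theorems.TypeILiouvilleRecurrentEternal

/-! ## §1 An eternal flow through every slice of a recurrent past -/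

/-- **AN ETERNAL FLOW THROUGH EVERY SLICE OF A UNIFORMLY RECURRENT PAST.**  For a uniformly recurrent class-P flow
`v` and `t₀ < 0` there is an eternal bounded Oseen-mild flow `W` — continuous on `ℝ × ℝ³`, weakly divergence free,
with the same bound, Oseen-mild between ALL pairs of times — whose time-`0` slice is `v(t₀)` (KNSS Lemma 6.1
compactness on the recurrence translates). [cite: KochNadirashviliSereginSverak2009, Lemma 6.1 (arXiv:0709.3599)] -/
theorem exists_eternal_through_slice_of_recurrent
    {v : ℝ → EuclideanSpace ℝ (Fin 3) → EuclideanSpace ℝ (Fin 3)} {K : ℝ}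
    (hc : ContinuousOn (uncurry v) (Iio 0 ×ˢ univ))
    (hK : ∀ t < 0, ∀ x, ‖v t x‖ ≤ K)
    (hd : ∀ t < 0, IsWeaklyDivFree (v t))
    (hm : ∀ s t : ℝ, s < t → t < 0 → ∀ x,
      v t x = heatExtension (v s) (t - s) x - oseenDuhamel 1 s v v t x)
    (hrec : ∀ t < 0, ∀ ε : ℝ, 0 < ε → ∀ T : ℝ, T < 0 → ∃ s : ℝ, s < T ∧ ∀ x, ‖v s x - v t x‖ ≤ ε)
    {t₀ : ℝ} (ht₀ : t₀ < 0) :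
    ∃ W : ℝ → EuclideanSpace ℝ (Fin 3) → EuclideanSpace ℝ (Fin 3),
      Continuous (uncurry W) ∧ (∀ t, IsWeaklyDivFree (W t)) ∧ (∀ t x, ‖W t x‖ ≤ K) ∧
      (∀ s t : ℝ, s < t → ∀ x, W t x = heatExtension (W s) (t - s) x - oseenDuhamel 1 s W W t x) ∧
      (∀ x, W 0 x = v t₀ x) := by
  -- recurrence times `s_k < -(k+2)` with `‖v(s_k) − v(t₀)‖ ≤ 1/(k+1)`
  have hsel : ∀ k : ℕ, ∃ s : ℝ, s < -((k : ℝ) + 2) ∧ ∀ x, ‖v s x - v t₀ x‖ ≤ 1 / ((k : ℝ) + 1) :=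
    fun k => hrec t₀ ht₀ _ (by positivity) _ (by have : (0 : ℝ) ≤ k := Nat.cast_nonneg k; linarith)
  choose sk hsk hclose using hsel
  -- the translates on the windows `(−(k+1), −s_k)`
  have H := fun k => TypeILiouvilleShadowExtraction.printClass_translate_window hc hK hd hm (sk k) 0
  have hAlim : Tendsto (fun k : ℕ => -((k : ℝ) + 1)) atTop atBot :=
    tendsto_neg_atTop_atBot.comp (tendsto_atTop_add_const_right atTop 1 tendsto_natCast_atTop_atTop)
  have hBlim : Tendsto (fun k : ℕ => -sk k) atTop atTop :=
    tendsto_atTop_mono (fun k => by linarith [hsk k]) tendsto_natCast_atTop_atTop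
  obtain ⟨φ, W, hφ, hWc, hWd, hWb, hWm, -, hpt, -⟩ :=
    TypeILiouvilleShadowExtraction.exists_oseenMild_eternal_limit
      (A := fun k : ℕ => -((k : ℝ) + 1)) (B := fun k => -sk k)
      (w := fun k t x => v (t + sk k) (x + 0)) (C := K) hAlim hBlim
      (fun k => (H k).1.mono (prod_mono Ioo_subset_Iio_self Subset.rfl))
      (fun k t ht => (H k).2.2.1 t ht.2)
      (fun k s t _ hst htB x => (H k).2.2.2 s t hst htB x)
      (fun k τ hτ x => (H k).2.1 τ hτ.2 x)
  refine ⟨W, hWc, hWd, hWb, hWm, fun x => ?_⟩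
  -- at time `0`: `v(s_{φ j}, x) → W(0,x)` and `v(s_{φ j}, x) → v(t₀, x)`
  have h1 : Tendsto (fun j => v (sk (φ j)) x) atTop (𝓝 (W 0 x)) := by
    have h := hpt 0 x
    simp only [zero_add, add_zero] at h
    exact h
  have h2 : Tendsto (fun j => v (sk (φ j)) x) atTop (𝓝 (v t₀ x)) := by
    rw [tendsto_iff_norm_sub_tendsto_zero]
    have hφt : Tendsto (fun j => (φ j : ℝ)) atTop atTop :=
      tendsto_natCast_atTop_atTop.comp hφ.tendsto_atTop
    have hinv : Tendsto (fun j => 1 / ((φ j : ℝ) + 1)) atTop (𝓝 0) :=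
      tendsto_one_div_add_atTop_nhds_zero_nat.comp hφ.tendsto_atTop
    exact squeeze_zero (fun j => norm_nonneg _) (fun j => hclose (φ j) x) hinv
  exact tendsto_nhds_unique h1 h2

/-! ## §2 The back-windows of a recurrent past embed into eternal flows -/

/-- **EVERY BACK-WINDOW OF A UNIFORMLY RECURRENT BOUNDED ANCIENT FLOW IS A WINDOW OF AN ETERNAL ONE**: for `t₀ < 0`
the eternal flow `W` of §1 satisfies `W(t − t₀) = v(t)` for all `t₀ ≤ t < 0` (forward uniqueness of bounded
Oseen-mild flows, `classP_eq_after_of_slice_eq`, applied to `v` and the ancient restriction of `t ↦ W(t − t₀)`).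
[cite: KochNadirashviliSereginSverak2009, §4 and Lemma 6.1 (arXiv:0709.3599)] -/
theorem exists_eternal_extension_of_recurrent
    {v : ℝ → EuclideanSpace ℝ (Fin 3) → EuclideanSpace ℝ (Fin 3)} {K : ℝ}
    (hc : ContinuousOn (uncurry v) (Iio 0 ×ˢ univ))
    (hK : ∀ t < 0, ∀ x, ‖v t x‖ ≤ K)
    (hd : ∀ t < 0, IsWeaklyDivFree (v t))
    (hm : ∀ s t : ℝ, s < t → t < 0 → ∀ x,
      v t x = heatExtension (v s) (t - s) x - oseenDuhamel 1 s v v t x)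
    (hrec : ∀ t < 0, ∀ ε : ℝ, 0 < ε → ∀ T : ℝ, T < 0 → ∃ s : ℝ, s < T ∧ ∀ x, ‖v s x - v t x‖ ≤ ε)
    {t₀ : ℝ} (ht₀ : t₀ < 0) :
    ∃ W : ℝ → EuclideanSpace ℝ (Fin 3) → EuclideanSpace ℝ (Fin 3),
      Continuous (uncurry W) ∧ (∀ t, IsWeaklyDivFree (W t)) ∧ (∀ t x, ‖W t x‖ ≤ K) ∧
      (∀ s t : ℝ, s < t → ∀ x, W t x = heatExtension (W s) (t - s) x - oseenDuhamel 1 s W W t x) ∧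
      (∀ t, t₀ ≤ t → t < 0 → ∀ x, W (t - t₀) x = v t x) := by
  obtain ⟨W, hWc, hWd, hWb, hWm, hW0⟩ := exists_eternal_through_slice_of_recurrent hc hK hd hm hrec ht₀
  refine ⟨W, hWc, hWd, hWb, hWm, fun t ht₀t ht x => ?_⟩
  -- the ancient flow `u t := W (t − t₀)` is in class P and has the slice `v t₀` at `t₀`
  have huc : ContinuousOn (uncurry fun t x => W (t - t₀) x) (Iio 0 ×ˢ univ) :=
    (hWc.comp (show Continuous (fun p : ℝ × EuclideanSpace ℝ (Fin 3) => (p.1 - t₀, p.2)) by fun_prop)).continuousOn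
  have huK : ∃ K : ℝ, ∀ t < 0, ∀ x, ‖W (t - t₀) x‖ ≤ K := ⟨K, fun t _ x => hWb _ x⟩
  have hum : ∀ s t : ℝ, s < t → t < 0 → ∀ x,
      W (t - t₀) x = heatExtension (W (s - t₀)) (t - s) x -
        oseenDuhamel 1 s (fun τ x => W (τ - t₀) x) (fun τ x => W (τ - t₀) x) t x := by
    intro s t hst _ x
    have h := hWm (s - t₀) (t - t₀) (by linarith) x
    rw [show t - t₀ - (s - t₀) = t - s by ring] at h
    rw [h, show (fun τ x => W (τ - t₀) x) = fun τ => W (τ + -t₀) from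
      funext fun τ => funext fun y => by rw [sub_eq_add_neg], oseenDuhamel_translate,
      ← sub_eq_add_neg, ← sub_eq_add_neg]
  rcases ht₀t.eq_or_lt with rfl | hlt
  · rw [sub_self]; exact hW0 x
  · have hslice : ∀ x, (fun t x => W (t - t₀) x) t₀ x = v t₀ x := fun x => by
      show W (t₀ - t₀) x = v t₀ x
      rw [sub_self]; exact hW0 x
    exact classP_eq_after_of_slice_eq huc huK hum hc ⟨K, hK⟩ hm hslice t ⟨hlt, ht⟩ x

/-! ## §3 The recurrent stratum of (L) is carried by ETERNAL LIOUVILLE -/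

/-- **EL ⟹ UNIFORMLY RECURRENT BOUNDED LIOUVILLE.**  Under ETERNAL LIOUVILLE (stmt-NavierStokesRegularity-18161,
`Theses.TypeTwoEternal.EternalLiouville`, BY NAME) every uniformly recurrent class-P flow is ONE constant vector:
each slice `v(t₀)` is the time-`0` slice of an eternal flow in EL's class (§1 + `eternal_package`), hence a constant
`b(t₀)`, and the slice constants of a class-P flow agree (KNSS Remark 6.1).  Contains the steady and the
time-periodic bridges. [cite: KochNadirashviliSereginSverak2009, §1 p. 3, Lemma 6.1, Remark 6.1 (arXiv:0709.3599)] -/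
theorem recurrentLiouville_of_eternalLiouville (hE : Theses.TypeTwoEternal.EternalLiouville) :
    ∀ v : ℝ → EuclideanSpace ℝ (Fin 3) → EuclideanSpace ℝ (Fin 3),
      ContinuousOn (uncurry v) (Iio 0 ×ˢ univ) →
      (∃ K : ℝ, ∀ t < 0, ∀ x, ‖v t x‖ ≤ K) →
      (∀ t < 0, IsWeaklyDivFree (v t)) →
      (∀ s t : ℝ, s < t → t < 0 → ∀ x,
        v t x = heatExtension (v s) (t - s) x - oseenDuhamel 1 s v v t x) →
      (∀ t < 0, ∀ ε : ℝ, 0 < ε → ∀ T : ℝ, T < 0 → ∃ s : ℝ, s < T ∧ ∀ x, ‖v s x - v t x‖ ≤ ε) →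
      ∃ b : EuclideanSpace ℝ (Fin 3), ∀ t < 0, ∀ x, v t x = b := by
  classical
  intro v hc hK hd hm hrec
  obtain ⟨K, hK⟩ := hK
  have hslice : ∀ t < 0, ∃ b : EuclideanSpace ℝ (Fin 3), ∀ x, v t x = b := by
    intro t₀ ht₀
    obtain ⟨W, hWc, hWd, hWb, hWm, hW0⟩ := exists_eternal_through_slice_of_recurrent hc hK hd hm hrec ht₀
    obtain ⟨h1, h2, h3, h4⟩ :=
      TypeILiouvilleShadowExtraction.eternal_package (W := W) (C := K) hWc hWd hWb hWm
    obtain ⟨b, hb⟩ := hE W h1 h2 h3 h4 0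
    exact ⟨b, fun x => by rw [← hW0 x]; exact hb x⟩
  set b : ℝ → EuclideanSpace ℝ (Fin 3) := fun t =>
    if ht : t < 0 then Classical.choose (hslice t ht) else 0 with hb_def
  have hub : ∀ t < 0, ∀ x, v t x = b t := by
    intro t ht x
    have h := Classical.choose_spec (hslice t ht) x
    simp only [hb_def, dif_pos ht]
    exact h
  have htime : ∀ s t : ℝ, s < 0 → t < 0 → b s = b t :=
    KNSS2009_remark61 one_pos hub fun s t hst ht => Eventually.of_forall fun x => by
      rw [one_mul]; exact hm s t hst ht x
  exact ⟨b (-1), fun t ht x => by rw [hub t ht x, htime t (-1) ht (by norm_num)]⟩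

/-- **(L) ⟹ UNIFORMLY RECURRENT BOUNDED LIOUVILLE** (through the landed `eternalLiouville_of_liouvilleL`); with
`TypeILiouvilleSteadySieve.liouvilleL_iff_sieved` this says: the recurrent stratum of (L) is EXACTLY EL's business.
[cite: KochNadirashviliSereginSverak2009, §1 p. 3 (arXiv:0709.3599)] -/
theorem recurrentLiouville_of_liouvilleL (hL : Theses.TypeILiouville.TypeIliouvilleL) :
    ∀ v : ℝ → EuclideanSpace ℝ (Fin 3) → EuclideanSpace ℝ (Fin 3),
      ContinuousOn (uncurry v) (Iio 0 ×ˢ univ) →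
      (∃ K : ℝ, ∀ t < 0, ∀ x, ‖v t x‖ ≤ K) →
      (∀ t < 0, IsWeaklyDivFree (v t)) →
      (∀ s t : ℝ, s < t → t < 0 → ∀ x,
        v t x = heatExtension (v s) (t - s) x - oseenDuhamel 1 s v v t x) →
      (∀ t < 0, ∀ ε : ℝ, 0 < ε → ∀ T : ℝ, T < 0 → ∃ s : ℝ, s < T ∧ ∀ x, ‖v s x - v t x‖ ≤ ε) →
      ∃ b : EuclideanSpace ℝ (Fin 3), ∀ t < 0, ∀ x, v t x = b :=
  recurrentLiouville_of_eternalLiouville (TypeILiouvilleQuiescentShadow.eternalLiouville_of_liouvilleL hL)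

/-! ## §4 (appended) Pointwise α-recurrence suffices -/

/-- **AN ETERNAL FLOW THROUGH EVERY POINTWISE α-RECURRENT SLICE.**  The compactness argument of §1 needs much less
than uniform recurrence: if the slice `v(t₀)` is the POINTWISE limit of slices `v(s_k)` along SOME sequence of times
`s_k → −∞` (i.e. `v(t₀)` is an α-limit slice of `v` in the topology of pointwise — equivalently, by the uniform
Hölder modulus of class P, locally uniform — convergence), then `v(t₀)` is the time-`0` slice of an eternal bounded
Oseen-mild flow.  (Subsequence with `s_{ψ k} < −(k+2)` by `Filter.extraction_forall_of_eventually`, then KNSS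
Lemma 6.1 on the translates as in §1.) [cite: KochNadirashviliSereginSverak2009, Lemma 6.1 (arXiv:0709.3599)] -/
theorem exists_eternal_through_slice_of_pointwiseRecurrent
    {v : ℝ → EuclideanSpace ℝ (Fin 3) → EuclideanSpace ℝ (Fin 3)} {K : ℝ}
    (hc : ContinuousOn (uncurry v) (Iio 0 ×ˢ univ))
    (hK : ∀ t < 0, ∀ x, ‖v t x‖ ≤ K)
    (hd : ∀ t < 0, IsWeaklyDivFree (v t))
    (hm : ∀ s t : ℝ, s < t → t < 0 → ∀ x,
      v t x = heatExtension (v s) (t - s) x - oseenDuhamel 1 s v v t x)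
    {t₀ : ℝ} {s : ℕ → ℝ} (hs : Tendsto s atTop atBot)
    (hlim : ∀ x, Tendsto (fun k => v (s k) x) atTop (𝓝 (v t₀ x))) :
    ∃ W : ℝ → EuclideanSpace ℝ (Fin 3) → EuclideanSpace ℝ (Fin 3),
      Continuous (uncurry W) ∧ (∀ t, IsWeaklyDivFree (W t)) ∧ (∀ t x, ‖W t x‖ ≤ K) ∧
      (∀ s t : ℝ, s < t → ∀ x, W t x = heatExtension (W s) (t - s) x - oseenDuhamel 1 s W W t x) ∧
      (∀ x, W 0 x = v t₀ x) := by
  -- a subsequence with `s (ψ k) < -(k+2)`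
  have hev : ∀ k : ℕ, ∀ᶠ n in atTop, s n < -((k : ℝ) + 2) := fun k =>
    hs.eventually (eventually_lt_atBot _)
  obtain ⟨ψ, hψ, hψs⟩ := extraction_forall_of_eventually hev
  set sk : ℕ → ℝ := fun k => s (ψ k) with hsk_def
  have hsk : ∀ k, sk k < -((k : ℝ) + 2) := fun k => hψs k
  -- the translates on the windows `(−(k+1), −s_{ψ k})`
  have H := fun k => TypeILiouvilleShadowExtraction.printClass_translate_window hc hK hd hm (sk k) 0
  have hAlim : Tendsto (fun k : ℕ => -((k : ℝ) + 1)) atTop atBot :=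
    tendsto_neg_atTop_atBot.comp (tendsto_atTop_add_const_right atTop 1 tendsto_natCast_atTop_atTop)
  have hBlim : Tendsto (fun k : ℕ => -sk k) atTop atTop :=
    tendsto_atTop_mono (fun k => by linarith [hsk k]) tendsto_natCast_atTop_atTop
  obtain ⟨φ, W, hφ, hWc, hWd, hWb, hWm, -, hpt, -⟩ :=
    TypeILiouvilleShadowExtraction.exists_oseenMild_eternal_limit
      (A := fun k : ℕ => -((k : ℝ) + 1)) (B := fun k => -sk k)
      (w := fun k t x => v (t + sk k) (x + 0)) (C := K) hAlim hBlim
      (fun k => (H k).1.mono (prod_mono Ioo_subset_Iio_self Subset.rfl))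
      (fun k t ht => (H k).2.2.1 t ht.2)
      (fun k s t _ hst htB x => (H k).2.2.2 s t hst htB x)
      (fun k τ hτ x => (H k).2.1 τ hτ.2 x)
  refine ⟨W, hWc, hWd, hWb, hWm, fun x => ?_⟩
  have h1 : Tendsto (fun j => v (sk (φ j)) x) atTop (𝓝 (W 0 x)) := by
    have h := hpt 0 x
    simp only [zero_add, add_zero] at h
    exact h
  have h2 : Tendsto (fun j => v (sk (φ j)) x) atTop (𝓝 (v t₀ x)) :=
    ((hlim x).comp hψ.tendsto_atTop).comp hφ.tendsto_atTop
  exact tendsto_nhds_unique h1 h2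

/-- Uniform recurrence (§1–§3) is a special case of pointwise α-recurrence: every slice of a uniformly recurrent
past is the pointwise (indeed uniform) limit of slices along some `s_k → −∞`. [folklore] -/
theorem pointwiseRecurrent_of_recurrent
    {v : ℝ → EuclideanSpace ℝ (Fin 3) → EuclideanSpace ℝ (Fin 3)}
    (hrec : ∀ t < 0, ∀ ε : ℝ, 0 < ε → ∀ T : ℝ, T < 0 → ∃ s : ℝ, s < T ∧ ∀ x, ‖v s x - v t x‖ ≤ ε)
    {t₀ : ℝ} (ht₀ : t₀ < 0) :
    ∃ s : ℕ → ℝ, Tendsto s atTop atBot ∧ ∀ x, Tendsto (fun k => v (s k) x) atTop (𝓝 (v t₀ x)) := by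
  have hsel : ∀ k : ℕ, ∃ s : ℝ, s < -((k : ℝ) + 1) ∧ ∀ x, ‖v s x - v t₀ x‖ ≤ 1 / ((k : ℝ) + 1) :=
    fun k => hrec t₀ ht₀ _ (by positivity) _ (by have : (0 : ℝ) ≤ k := Nat.cast_nonneg k; linarith)
  choose s hs hclose using hsel
  refine ⟨s, ?_, fun x => ?_⟩
  · have hlin : Tendsto (fun k : ℕ => -((k : ℝ) + 1)) atTop atBot :=
      tendsto_neg_atTop_atBot.comp (tendsto_atTop_add_const_right atTop 1 tendsto_natCast_atTop_atTop)
    exact tendsto_atBot_mono (fun k => (hs k).le) hlin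
  · rw [tendsto_iff_norm_sub_tendsto_zero]
    exact squeeze_zero (fun k => norm_nonneg _) (fun k => hclose k x) tendsto_one_div_add_atTop_nhds_zero_nat

/-- **EL ⟹ α-RECURRENT BOUNDED LIOUVILLE.**  Under ETERNAL LIOUVILLE (stmt-NavierStokesRegularity-18161, BY NAME)
every class-P flow EACH OF WHOSE SLICES IS A POINTWISE α-LIMIT OF ITS OWN PAST (`∀ t < 0, ∃ s_k → −∞,
v(s_k, x) → v(t, x) ∀ x`; ⊇ uniformly recurrent ⊇ steady ∪ periodic ∪ almost-periodic, and flows recurrent only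
locally in space) is ONE constant vector. [cite: KochNadirashviliSereginSverak2009, §1 p. 3, Lemma 6.1, Remark 6.1 (arXiv:0709.3599)] -/
theorem alphaRecurrentLiouville_of_eternalLiouville (hE : Theses.TypeTwoEternal.EternalLiouville) :
    ∀ v : ℝ → EuclideanSpace ℝ (Fin 3) → EuclideanSpace ℝ (Fin 3),
      ContinuousOn (uncurry v) (Iio 0 ×ˢ univ) →
      (∃ K : ℝ, ∀ t < 0, ∀ x, ‖v t x‖ ≤ K) →
      (∀ t < 0, IsWeaklyDivFree (v t)) →
      (∀ s t : ℝ, s < t → t < 0 → ∀ x,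
        v t x = heatExtension (v s) (t - s) x - oseenDuhamel 1 s v v t x) →
      (∀ t < 0, ∃ s : ℕ → ℝ, Tendsto s atTop atBot ∧ ∀ x, Tendsto (fun k => v (s k) x) atTop (𝓝 (v t x))) →
      ∃ b : EuclideanSpace ℝ (Fin 3), ∀ t < 0, ∀ x, v t x = b := by
  classical
  intro v hc hK hd hm hrec
  obtain ⟨K, hK⟩ := hK
  have hslice : ∀ t < 0, ∃ b : EuclideanSpace ℝ (Fin 3), ∀ x, v t x = b := by
    intro t₀ ht₀
    obtain ⟨s, hs, hlim⟩ := hrec t₀ ht₀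
    obtain ⟨W, hWc, hWd, hWb, hWm, hW0⟩ :=
      exists_eternal_through_slice_of_pointwiseRecurrent hc hK hd hm hs hlim
    obtain ⟨h1, h2, h3, h4⟩ :=
      TypeILiouvilleShadowExtraction.eternal_package (W := W) (C := K) hWc hWd hWb hWm
    obtain ⟨b, hb⟩ := hE W h1 h2 h3 h4 0
    exact ⟨b, fun x => by rw [← hW0 x]; exact hb x⟩
  set b : ℝ → EuclideanSpace ℝ (Fin 3) := fun t =>
    if ht : t < 0 then Classical.choose (hslice t ht) else 0 with hb_def
  have hub : ∀ t < 0, ∀ x, v t x = b t := by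
    intro t ht x
    have h := Classical.choose_spec (hslice t ht) x
    simp only [hb_def, dif_pos ht]
    exact h
  have htime : ∀ s t : ℝ, s < 0 → t < 0 → b s = b t :=
    KNSS2009_remark61 one_pos hub fun s t hst ht => Eventually.of_forall fun x => by
      rw [one_mul]; exact hm s t hst ht x
  exact ⟨b (-1), fun t ht x => by rw [hub t ht x, htime t (-1) ht (by norm_num)]⟩

/-- **(L) ⟹ α-RECURRENT BOUNDED LIOUVILLE** (through `eternalLiouville_of_liouvilleL`). [cite: KochNadirashviliSereginSverak2009, §1 p. 3 (arXiv:0709.3599)] -/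
theorem alphaRecurrentLiouville_of_liouvilleL (hL : Theses.TypeILiouville.TypeIliouvilleL) :
    ∀ v : ℝ → EuclideanSpace ℝ (Fin 3) → EuclideanSpace ℝ (Fin 3),
      ContinuousOn (uncurry v) (Iio 0 ×ˢ univ) →
      (∃ K : ℝ, ∀ t < 0, ∀ x, ‖v t x‖ ≤ K) →
      (∀ t < 0, IsWeaklyDivFree (v t)) →
      (∀ s t : ℝ, s < t → t < 0 → ∀ x,
        v t x = heatExtension (v s) (t - s) x - oseenDuhamel 1 s v v t x) →
      (∀ t < 0, ∃ s : ℕ → ℝ, Tendsto s atTop atBot ∧ ∀ x, Tendsto (fun k => v (s k) x) atTop (𝓝 (v t x))) →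
      ∃ b : EuclideanSpace ℝ (Fin 3), ∀ t < 0, ∀ x, v t x = b :=
  alphaRecurrentLiouville_of_eternalLiouville (TypeILiouvilleQuiescentShadow.eternalLiouville_of_liouvilleL hL)

end Summit.NavierStokesRegularity.NavierStokesRegularity.Theorems.TypeILiouvilleRecurrentEternal

end
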